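import Summits.BirchSwinnertonDyer.BirchSwinnertonDyer.Theorems.ByReductionTypeAtTwoRankOneAtTwoOffBigImageOddLocalDeepGlue
import Summits.BirchSwinnertonDyer.BirchSwinnertonDyer.Theorems.ByReductionTypeAtTwoRankOneAtTwoOffBigImageOddLocalSiblingBridge
import Summits.BirchSwinnertonDyer.BirchSwinnertonDyer.Theorems.ByReductionTypeAtTwoRankOneAtTwoOffBigImageOddLocalShiftedSiblingBridge
import HarnessLib

/-!
# Route `ByReductionTypeAtTwo`, crux `RankOneAtTwoOffBigImageOddLocal` (stmt-BirchSwinnertonDyer-23716), line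
# `refined_kolyvagin_tamagawa_shift_at_two`: the re-cut's glue on the FULL-IMAGE cell — 22137 (σ = 0) + 27469 (Δ < 0) BY NAME + the deep
# `σ ≥ 1`, `Δ > 0` stub ⟹ deep K3 on δ (PROVED)

Lead prover `prover-cruxlead-stmt-BirchSwinnertonDyer-23716-g6` (2026-08-28), `--supports stmt-BirchSwinnertonDyer-23716` (helper; closes nothing).
THEOREMS ONLY.  The deep-currency twin of the skeleton's `structureWithOn_fullImage_of_names_of_pos` (g11): over the sibling bridges
`…OffBigImageOddLocalSiblingBridge.lean` (p660076: 22137 `KolyvaginExactAtTwo` ⟹ S5″ at `σ = 0`) and `…OffBigImageOddLocalShiftedSiblingBridge.lean`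
(p663057: 27469 `KolyvaginExactAtTwoShifted` ⟹ S5″ on {full image, `Δ < 0`}), the DEEP structure statement `ShiftedKolyvaginStructureModTwoDeepWithOn Φ
OnFullImageCell` (witness also at level `≥ M₀ + 1`, filter `Φ`) follows from the two sibling items BY NAME and the lead's re-cut stub
`ShiftedKolyvaginStructureModTwoDeepWithOnPos Φ OnDeltaPlusCell`; the by-name branches take the witness in THEIR currency (level `≥ σ + 1`, numerical
primes), which the deep hypotheses supply a fortiori.  Imports the sibling route's Theses file through the bridges (theses-cone, as the bridges
themselves).  BSD is not proved by any of this; the crux is not proved.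

References: [McCallumLMS1991] §5 Thm. 5.4; [WZhang2014] Notations (xii).
-/

set_option linter.dupNamespace false -- tree convention: `Summit.BirchSwinnertonDyer.BirchSwinnertonDyer.Theorems` (summit = sub-problem)
set_option autoImplicit false

noncomputable section

open scoped Classical

namespace Summit.BirchSwinnertonDyer.BirchSwinnertonDyer.Theorems.OffBigImageOddLocalAtTwo

open WeierstrassCurve NumberField Literature.NumberTheory.EllipticCurves
  Literature.NumberTheory.EllipticCurves.ModularForms
  Summit.BirchSwinnertonDyer.BirchSwinnertonDyer.Theses.GenusKolyvaginAtTwo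

/-- **THE RE-CUT'S GLUE ON THE FULL-IMAGE CELL**: deep K3 with filter `Φ` on the WHOLE full-image cell δ from — 22137 `KolyvaginExactAtTwo` (the data with
`σ(W, Dt) = 0`, either sign of `Δ`; bridge p660076), 27469 `KolyvaginExactAtTwoShifted` (every datum on `Δ < 0`; bridge p663057), and the deep
`σ ≥ 1` statement on the `Δ > 0` full-image cell (the lead's re-cut stub).  The by-name branches take their witness in THEIR currency (level
`≥ σ + 1`, numerical primes), which the deep hypotheses supply a fortiori (the extra level line and the filter are dropped). [cite: McCallumLMS1991, §5 Thm. 5.4] -/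
theorem structureDeepWithOn_fullImage_of_names_of_posDeep (Φ : WeierstrassCurve ℚ → ℕ → Prop)
    (h0 : KolyvaginExactAtTwo) (hS : KolyvaginExactAtTwoShifted)
    (hpos : ShiftedKolyvaginStructureModTwoDeepWithOnPos Φ OnDeltaPlusCell) :
    ShiftedKolyvaginStructureModTwoDeepWithOn Φ OnFullImageCell := by
  intro W _ _ _ hCM hρ hW K _ _ hK hodd h3 hH hsq1 hsq2 Dt β ι d₁ hy M₀ hdiv hndiv hacc n d hn hKoly hlev hlev' hPn
  have hfull : ∀ m : ℕ, W.HasSurjectiveModNGaloisRep ((2 ^ m : ℕ) : ℤ) := fun m => hW m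
  by_cases hσ : sigmaShift W Dt = 0
  · exact shiftedStructure_of_kolyvaginExactAtTwo_of_sigmaShift_eq_zero h0 W hCM hfull K hK hodd h3 hH hsq1 hsq2 Dt β ι d₁ hy hσ
      M₀ hdiv hndiv n d hn (fun ℓ hℓ => (hKoly ℓ hℓ).1) hPn
  rcases lt_or_gt_of_ne (W.isUnit_Δ.ne_zero) with hneg | hposΔ
  · exact shiftedStructure_of_kolyvaginExactAtTwoShifted hS W hCM hneg hfull K hK hodd h3 hH hsq1 hsq2 Dt β ι d₁ hy M₀ hdiv hndiv
      hacc n d hn (fun ℓ hℓ => (hKoly ℓ hℓ).1) hlev hPn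
  · exact hpos W hCM hρ ⟨hposΔ, fun n => hfull n⟩ K hK hodd h3 hH hsq1 hsq2 Dt β ι d₁ hy (Nat.pos_of_ne_zero hσ) M₀ hdiv hndiv
      hacc n d hn hKoly hlev hlev' hPn

end Summit.BirchSwinnertonDyer.BirchSwinnertonDyer.Theorems.OffBigImageOddLocalAtTwo

end
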